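import Summits.QuantumFields.YangMills.Theorems.AtomicCalibrationRMirrorCalibrationDefs
import Summits.QuantumFields.YangMills.Theses.OnsetTautology
import Summits.QuantumFields.YangMills.Theses.SquareRootCeilings
import Summits.QuantumFields.YangMills.Theses.OnsetCalibration
import Summits.QuantumFields.YangMills.Theorems.OnsetCalibrationOnsetVanishes
import Summits.QuantumFields.YangMills.Theorems.OnsetTautologyOnsetContraction
import Summits.QuantumFields.YangMills.Theorems.OnsetTautologyAdmissibleAtomProfile
import Summits.QuantumFields.YangMills.Theorems.BalabanLadderUVSeamRecUnitDilation
import Summits.QuantumFields.YangMills.Theorems.InfiniteVolumeMomentBounds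
import HarnessLib

/-!
# B6 `stub_mirrorCalibration` of LINE «MirrorCalibration» on crux ⟨stmt-QuantumFields-28169⟩ — part 1/2:
# the joint-onset unit from `OnsetFloors`, the two-point ceiling in odd-torus limit states, atom geometry

Author of the mathematics and of the Lean proof: planner **ym-idea-11 g15** (HOME `ideators/ym-idea-11/g15/bc/mc_b6.lean`,
sha aced21bb, verified by idea-crit-9 ACK #86b); landed unchanged (split at the 400-line cap, §0/§1b currency defs replaced by the
import of `Theorems/AtomicCalibrationRMirrorCalibrationDefs.lean` = critic price #86 P2) by the LEAD seat ym-line-sfw-p2 g74 as a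
landing service.

Content of part 1 (§R and the geometric half of the source): `jointOnsetUnit`, `jointOnsetUnit_of_onsetFloors{,_level}`
(the rung: level `ε := min ε₁ ε₀`, joint onset set, unit `a(β)` above `sSup/2`, `a → 0` by the landed `OnsetVanishes`,
floors at the unit, every floor scale `< 2aβ`); `twoPoint_limitState` (the n = 2 inheritance of the sub-onset two-point
ceiling by odd-torus limit states); atom-weight support/size lemmas (`atomWt_ne_zero_iff`, `abs_atomWt_le`, time floor /
ceiling of the atom and its reflection, coordinates bounded by the carrier) and the finite `carrier` with its cardinality.
Part 2 (`AtomicCalibrationRMirrorCalibration.lean`) bounds `rpSquare` in the coarse and fine regimes and proves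
`stub_mirrorCalibration : OnsetFloors → SubOnsetTwoPointCeilings → MirrorCalibratedUnit`.

HONEST LABEL: calibration/bookkeeping under OPEN wall-class hypotheses (`OnsetFloors` 25892, `SubOnsetTwoPointCeilings`
26671); nothing here proves NT, a β-uniform bound, the leaf 19868, any crux, rung or summit; the Yang–Mills mass gap is
NOT proved.
-/

set_option autoImplicit false

noncomputable section

open scoped BigOperators
open MeasureTheory Filter Topology
open Literature.MathematicalPhysics.QuantumFieldTheory Literature.MathematicalPhysics.QuantumLattice
open Literature.Probability.LatticeModels (Site)
open Summit.QuantumFields.YangMills.Theorems.InfiniteVolume (stateMomentStr measurable_plane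
  abs_integral_centred_prod_le_of_eventually eventually_torusSeparated eventually_le_of_strictMono)
open Summit.QuantumFields.YangMills.Theorems.InfVolRP (centreOffset centreOffset_time norm_centreOffset_le_one)
open Summit.QuantumFields.YangMills.Theorems.OnsetTautologyOnsetContraction (stateMomentStr_two abs_centredPlane_le
  abs_coord_le_of_ne_zero)
open Summit.QuantumFields.YangMills.Theses.OnsetTautology (AdmissibleAtomProfile)
open Summit.QuantumFields.YangMills.Cruxes.OSLegsFromFemtoAndGap.DlrCollarTransfer

namespace Summit.QuantumFields.YangMills.Cruxes.AtomicCalibrationR.MirrorCalibration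

variable {G : Type} [Group G] [TopologicalSpace G] [IsTopologicalGroup G] [CompactSpace G]
  [MeasurableSpace G] [BorelSpace G]

/-! ## §R The proved rung (copied from g15/bc/mc_rung.lean) -/

/-- **Joint-onset calibration (core, one group).**  From a joint-floor datum at level `ε` (some scale `s ∈ (0,1]`
carries both floors at every `β ≥ β₅`) and the vanishing of the onset (`hvan`, = `OnsetVanishes` read at this datum):
a unit `a` with `0 < a ≤ 1`, `a → 0`, `LowerBounds G r a`, the floors at the unit, and every joint-floor scale `< 2a`. -/
theorem jointOnsetUnit {G : Type} [Group G] [TopologicalSpace G] [IsTopologicalGroup G] [CompactSpace G]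
    [MeasurableSpace G] [BorelSpace G]
    (r : LatticeRep G) (v f g h : SchwartzMap (EuclideanSpace ℝ (Fin 4)) ℝ) (ε Λ₅ β₅ : ℝ) (hε : 0 < ε)
    (hv : tsupport v ⊆ {y : EuclideanSpace ℝ (Fin 4) | 0 < y 0})
    (hfg : Disjoint (tsupport f) (tsupport g)) (hgh : Disjoint (tsupport g) (tsupport h))
    (hfh : Disjoint (tsupport f) (tsupport h))
    (hfloor : ∀ β : ℝ, β₅ ≤ β → ∃ s : ℝ, 0 < s ∧ s ≤ 1 ∧
      (∀ L : ℕ, Λ₅ ≤ s * L → ε ≤ Q2 G r β L s (thetaTest 4 v) v) ∧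
      (∀ L : ℕ, Λ₅ ≤ s * L → ε ≤ |Q3 G r β L s f g h|))
    (hvan : ∀ s₀ : ℝ, 0 < s₀ → ∃ β₁ : ℝ, ∀ β : ℝ, β₁ ≤ β → ∀ s : ℝ, s₀ ≤ s → s ≤ 1 →
      ¬ ((∀ L : ℕ, Λ₅ ≤ s * L → ε ≤ Q2 G r β L s (thetaTest 4 v) v) ∧
         (∀ L : ℕ, Λ₅ ≤ s * L → ε ≤ |Q3 G r β L s f g h|))) :
    ∃ a : ℝ → ℝ, (∀ β, 0 < a β) ∧ (∀ β, a β ≤ 1) ∧ Tendsto a atTop (nhds 0) ∧ LowerBounds G r a ∧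
      ∀ β : ℝ, β₅ ≤ β →
        ((∀ L : ℕ, Λ₅ ≤ a β * L → ε ≤ Q2 G r β L (a β) (thetaTest 4 v) v) ∧
         (∀ L : ℕ, Λ₅ ≤ a β * L → ε ≤ |Q3 G r β L (a β) f g h|)) ∧
        ∀ s : ℝ, 0 < s → s ≤ 1 →
          (∀ L : ℕ, Λ₅ ≤ s * L → ε ≤ Q2 G r β L s (thetaTest 4 v) v) →
          (∀ L : ℕ, Λ₅ ≤ s * L → ε ≤ |Q3 G r β L s f g h|) → s < 2 * a β := by
  -- the joint onset set `S β` (opaque, with its membership lemma)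
  obtain ⟨S, hS⟩ : ∃ S : ℝ → Set ℝ, ∀ β s, s ∈ S β ↔ (0 < s ∧ s ≤ 1 ∧
      (∀ L : ℕ, Λ₅ ≤ s * L → ε ≤ Q2 G r β L s (thetaTest 4 v) v) ∧
      (∀ L : ℕ, Λ₅ ≤ s * L → ε ≤ |Q3 G r β L s f g h|)) :=
    ⟨fun β => {s | 0 < s ∧ s ≤ 1 ∧
      (∀ L : ℕ, Λ₅ ≤ s * L → ε ≤ Q2 G r β L s (thetaTest 4 v) v) ∧
      (∀ L : ℕ, Λ₅ ≤ s * L → ε ≤ |Q3 G r β L s f g h|)}, fun _ _ => Iff.rfl⟩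
  have hSbdd : ∀ β, BddAbove (S β) := fun β => ⟨1, fun s hs => ((hS β s).1 hs).2.1⟩
  have hSne : ∀ β : ℝ, β₅ ≤ β → (S β).Nonempty := fun β hβ => by
    obtain ⟨s, hs0, hs1, h2, h3⟩ := hfloor β hβ
    exact ⟨s, (hS β s).2 ⟨hs0, hs1, h2, h3⟩⟩
  -- the calibrated unit: a joint-floor scale above half the top of the onset set
  have hex : ∀ β : ℝ, ∃ s : ℝ, 0 < s ∧ s ≤ 1 ∧ ((S β).Nonempty → s ∈ S β ∧ sSup (S β) / 2 < s) := by
    intro β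
    by_cases hne : (S β).Nonempty
    · have hpos : 0 < sSup (S β) := by
        obtain ⟨s, hs⟩ := hne
        exact lt_of_lt_of_le ((hS β s).1 hs).1 (le_csSup (hSbdd β) hs)
      obtain ⟨s, hs, hlt⟩ := exists_lt_of_lt_csSup hne (show sSup (S β) / 2 < sSup (S β) by linarith)
      exact ⟨s, ((hS β s).1 hs).1, ((hS β s).1 hs).2.1, fun _ => ⟨hs, hlt⟩⟩
    · exact ⟨1, one_pos, le_rfl, fun h' => (hne h').elim⟩
  choose a ha_pos ha_le ha_mem using hex
  refine ⟨a, ha_pos, ha_le, ?_, ?_, ?_⟩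
  · -- the unit tends to zero: `OnsetVanishes` at this datum
    rw [Metric.tendsto_atTop]
    intro s₀ hs₀
    obtain ⟨β₁, hβ₁⟩ := hvan s₀ hs₀
    refine ⟨max β₁ β₅, fun β hβ => ?_⟩
    have hmem := (hS β (a β)).1 ((ha_mem β (hSne β (le_of_max_le_right hβ))).1)
    rw [Real.dist_0_eq_abs, abs_of_pos (ha_pos β)]
    exact lt_of_not_ge fun hcon => hβ₁ β (le_of_max_le_left hβ) (a β) hcon hmem.2.1 ⟨hmem.2.2.1, hmem.2.2.2⟩
  · -- the floors at the calibrated unit, by membership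
    refine ⟨⟨v, ε, β₅, Λ₅, hv, hε, fun β hβ L hL => ?_⟩,
      ⟨f, g, h, ε, β₅, Λ₅, hfg, hgh, hfh, hε, fun β hβ L hL => ?_⟩⟩
    · have hmem := (hS β (a β)).1 ((ha_mem β (hSne β hβ)).1)
      exact hmem.2.2.1 L hL
    · have hmem := (hS β (a β)).1 ((ha_mem β (hSne β hβ)).1)
      exact hmem.2.2.2 L hL
  · -- the unit is a joint-floor scale and dominates half of every joint-floor scale
    intro β hβ
    have hmem := (hS β (a β)).1 ((ha_mem β (hSne β hβ)).1)
    refine ⟨⟨hmem.2.2.1, hmem.2.2.2⟩, fun s hs0 hs1 h2 h3 => ?_⟩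
    have hsS : s ∈ S β := (hS β s).2 ⟨hs0, hs1, h2, h3⟩
    have hle : s ≤ sSup (S β) := le_csSup (hSbdd β) hsS
    have hlt := (ha_mem β (hSne β hβ)).2
    linarith

/-- **BC5 FIRST RUNG of stub B6 — the domination-free half of `MirrorCalibratedUnit` from the shared residual
`OnsetFloors` (stmt-QuantumFields-25892), PROVED.**  For every SU(2)-class `G`: `r`, a unit `0 < a ≤ 1` with `a → 0`
and `LowerBounds G r a`, and a joint-floor datum at level `ε > 0` such that from `β₅` on the unit carries both floors
and every joint-floor scale in `(0,1]` is `< 2 a β`. -/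
theorem jointOnsetUnit_of_onsetFloors
    (hF : Summit.QuantumFields.YangMills.Theses.OnsetCalibration.OnsetFloors) :
    ∀ (G : Type) [Group G] [TopologicalSpace G] [IsTopologicalGroup G] [CompactSpace G],
    IsCompactSimpleLieGroup G → Nonempty (G ≃ₜ* Matrix.specialUnitaryGroup (Fin 2) ℂ) →
    letI : MeasurableSpace G := borel G
    haveI : BorelSpace G := ⟨rfl⟩
    ∃ (r : LatticeRep G) (a : ℝ → ℝ) (v f g h : SchwartzMap (EuclideanSpace ℝ (Fin 4)) ℝ) (ε Λ₅ β₅ : ℝ),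
      (∀ β, 0 < a β) ∧ (∀ β, a β ≤ 1) ∧ Tendsto a atTop (nhds 0) ∧ LowerBounds G r a ∧
      tsupport v ⊆ {y : EuclideanSpace ℝ (Fin 4) | 0 < y 0} ∧
      Disjoint (tsupport f) (tsupport g) ∧ Disjoint (tsupport g) (tsupport h) ∧ Disjoint (tsupport f) (tsupport h) ∧
      0 < ε ∧
      ∀ β : ℝ, β₅ ≤ β →
        ((∀ L : ℕ, Λ₅ ≤ a β * L → ε ≤ Q2 G r β L (a β) (thetaTest 4 v) v) ∧
         (∀ L : ℕ, Λ₅ ≤ a β * L → ε ≤ |Q3 G r β L (a β) f g h|)) ∧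
        ∀ s : ℝ, 0 < s → s ≤ 1 →
          (∀ L : ℕ, Λ₅ ≤ s * L → ε ≤ Q2 G r β L s (thetaTest 4 v) v) →
          (∀ L : ℕ, Λ₅ ≤ s * L → ε ≤ |Q3 G r β L s f g h|) → s < 2 * a β := by
  intro G _ _ _ _ hG hcl
  letI : MeasurableSpace G := borel G
  haveI : BorelSpace G := ⟨rfl⟩
  obtain ⟨r, v, f, g, h, ε, Λ₅, β₅, hv, hfg, hgh, hfh, hε, hfloor⟩ := hF G hG hcl
  have hvan := fun (s₀ : ℝ) (hs₀ : 0 < s₀) =>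
    Summit.QuantumFields.YangMills.Theorems.OnsetCalibration.onsetVanishes_proof G hG hcl r v f g h ε Λ₅ s₀ hε hs₀
  obtain ⟨a, ha_pos, ha_le, ha0, hlb, hcal⟩ :=
    jointOnsetUnit r v f g h ε Λ₅ β₅ hε hv hfg hgh hfh hfloor hvan
  exact ⟨r, a, v, f, g, h, ε, Λ₅, β₅, ha_pos, ha_le, ha0, hlb, hv, hfg, hgh, hfh, hε, hcal⟩

/-- **The rung at every lower level** (the form stub B6 consumes: the sub-onset ceiling `SubOnsetTwoPointCeilings`
fixes an admissible level `ε₀` for the datum, and the calibration is run at `ε := min ε₁ ε₀`).  `OnsetFloors` gives a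
datum at level `ε₁`; for EVERY `0 < ε ≤ ε₁` there is a unit as in `jointOnsetUnit` at level `ε`. -/
theorem jointOnsetUnit_of_onsetFloors_level
    (hF : Summit.QuantumFields.YangMills.Theses.OnsetCalibration.OnsetFloors) :
    ∀ (G : Type) [Group G] [TopologicalSpace G] [IsTopologicalGroup G] [CompactSpace G],
    IsCompactSimpleLieGroup G → Nonempty (G ≃ₜ* Matrix.specialUnitaryGroup (Fin 2) ℂ) →
    letI : MeasurableSpace G := borel G
    haveI : BorelSpace G := ⟨rfl⟩
    ∃ (r : LatticeRep G) (v f g h : SchwartzMap (EuclideanSpace ℝ (Fin 4)) ℝ) (ε₁ Λ₅ β₅ : ℝ),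
      tsupport v ⊆ {y : EuclideanSpace ℝ (Fin 4) | 0 < y 0} ∧
      Disjoint (tsupport f) (tsupport g) ∧ Disjoint (tsupport g) (tsupport h) ∧ Disjoint (tsupport f) (tsupport h) ∧
      0 < ε₁ ∧
      (∀ β : ℝ, β₅ ≤ β → ∃ s : ℝ, 0 < s ∧ s ≤ 1 ∧
        (∀ L : ℕ, Λ₅ ≤ s * L → ε₁ ≤ Q2 G r β L s (thetaTest 4 v) v) ∧
        (∀ L : ℕ, Λ₅ ≤ s * L → ε₁ ≤ |Q3 G r β L s f g h|)) ∧
      ∀ ε : ℝ, 0 < ε → ε ≤ ε₁ →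
        ∃ a : ℝ → ℝ, (∀ β, 0 < a β) ∧ (∀ β, a β ≤ 1) ∧ Tendsto a atTop (nhds 0) ∧ LowerBounds G r a ∧
          ∀ β : ℝ, β₅ ≤ β →
            ((∀ L : ℕ, Λ₅ ≤ a β * L → ε ≤ Q2 G r β L (a β) (thetaTest 4 v) v) ∧
             (∀ L : ℕ, Λ₅ ≤ a β * L → ε ≤ |Q3 G r β L (a β) f g h|)) ∧
            ∀ s : ℝ, 0 < s → s ≤ 1 →
              (∀ L : ℕ, Λ₅ ≤ s * L → ε ≤ Q2 G r β L s (thetaTest 4 v) v) →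
              (∀ L : ℕ, Λ₅ ≤ s * L → ε ≤ |Q3 G r β L s f g h|) → s < 2 * a β := by
  intro G _ _ _ _ hG hcl
  letI : MeasurableSpace G := borel G
  haveI : BorelSpace G := ⟨rfl⟩
  obtain ⟨r, v, f, g, h, ε₁, Λ₅, β₅, hv, hfg, hgh, hfh, hε₁, hfloor⟩ := hF G hG hcl
  refine ⟨r, v, f, g, h, ε₁, Λ₅, β₅, hv, hfg, hgh, hfh, hε₁, hfloor, fun ε hε hle => ?_⟩
  -- the floors at the lower level `ε`
  have hfloorε : ∀ β : ℝ, β₅ ≤ β → ∃ s : ℝ, 0 < s ∧ s ≤ 1 ∧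
      (∀ L : ℕ, Λ₅ ≤ s * L → ε ≤ Q2 G r β L s (thetaTest 4 v) v) ∧
      (∀ L : ℕ, Λ₅ ≤ s * L → ε ≤ |Q3 G r β L s f g h|) := by
    intro β hβ
    obtain ⟨s, hs0, hs1, h2, h3⟩ := hfloor β hβ
    exact ⟨s, hs0, hs1, fun L hL => hle.trans (h2 L hL), fun L hL => hle.trans (h3 L hL)⟩
  have hvan := fun (s₀ : ℝ) (hs₀ : 0 < s₀) =>
    Summit.QuantumFields.YangMills.Theorems.OnsetCalibration.onsetVanishes_proof G hG hcl r v f g h ε Λ₅ s₀ hε hs₀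
  exact jointOnsetUnit r v f g h ε Λ₅ β₅ hε hv hfg hgh hfh hfloorε hvan


/-! ## §L Bookkeeping lemmas for the domination half -/

/-- Offsets in the cell `[0,s]⁴` have norm `≤ 2s`. -/
theorem norm_le_two_mul_of_box {s : ℝ} {y : EuclideanSpace ℝ (Fin 4)} (hy : ∀ i, 0 ≤ y i ∧ y i ≤ s) :
    ‖y‖ ≤ 2 * s := by
  have hs : 0 ≤ s := (hy 0).1.trans (hy 0).2
  have hsum : ∑ i : Fin 4, ‖y i‖ ^ 2 ≤ (2 * s) ^ 2 := by
    calc ∑ i : Fin 4, ‖y i‖ ^ 2 ≤ ∑ _i : Fin 4, s ^ 2 := Finset.sum_le_sum fun i _ => by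
            rw [Real.norm_eq_abs, sq_abs]; nlinarith [(hy i).1, (hy i).2]
      _ = (2 * s) ^ 2 := by simp; ring
  rw [EuclideanSpace.norm_eq]
  calc Real.sqrt (∑ i, ‖y i‖ ^ 2) ≤ Real.sqrt ((2 * s) ^ 2) := Real.sqrt_le_sqrt hsum
    _ = 2 * s := Real.sqrt_sq (by linarith)

omit [IsTopologicalGroup G] [CompactSpace G] [BorelSpace G] in
/-- The centred two-point weight is bounded by `(2Cp)²` in any probability state. -/
theorem abs_stateMomentStr_two_le (r : LatticeRep G) (μ : Measure (LGConfig 4 G)) [IsProbabilityMeasure μ] {Cp : ℝ}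
    (hCp : ∀ (q : Fin 4 × Fin 4) (x : Fin 4 → ℤ) (U : LGConfig 4 G), |plane G r q x U| ≤ Cp)
    (q q' : Fin 4 × Fin 4) (x x' : Site 4) :
    |stateMomentStr G r μ 2 ![q, q'] ![x, x']| ≤ (2 * Cp) ^ 2 := by
  rw [stateMomentStr_two]
  have h := norm_integral_le_of_norm_le_const (μ := μ)
    (f := fun U => (plane G r q x U - ∫ V, plane G r q x V ∂μ) * (plane G r q' x' U - ∫ V, plane G r q' x' V ∂μ))
    (C := (2 * Cp) ^ 2) (Eventually.of_forall fun U => by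
      rw [Real.norm_eq_abs, abs_mul, sq]
      exact mul_le_mul (abs_centredPlane_le r μ hCp q x U) (abs_centredPlane_le r μ hCp q' x' U) (abs_nonneg _)
        ((abs_nonneg _).trans (abs_centredPlane_le r μ hCp q x U)))
  rwa [Real.norm_eq_abs, probReal_univ, mul_one] at h

/-- **Inheritance of a torus two-point ceiling by the odd-torus limit states** (the `n = 2` case of
`InfiniteVolume.momentBounds6_oddTorusLimitPoints`, same proof): a bound on the torus-centred covariance of two
plane fields at torus-separated sites, valid on all large odd tori, bounds the `μ`-centred covariance in every
`μ ∈ oddTorusLimitPoints r β` at `ℤ⁴`-separated sites. -/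
theorem twoPoint_limitState (r : LatticeRep G) {β : ℝ} {bnd : ℝ} {R : ℕ}
    (h2 : ∀ (L : ℕ) (q q' : Fin 4 × Fin 4) (x y : Fin 4 → ℤ), q.1 < q.2 → q'.1 < q'.2 → 4 * R + 8 ≤ L →
      (∃ k : Fin 4, (2 * (R : ℤ) + 4) ≤ |((((x k - y k : ℤ) : ZMod (2 * L + 1))).valMinAbs : ℤ)|) →
      |torusE G r β L (fun U => (plane G r q x U - torusE G r β L (plane G r q x)) *
        (plane G r q' y U - torusE G r β L (plane G r q' y)))| ≤ bnd)
    {μ : Measure (LGConfig 4 G)} (hμ : μ ∈ oddTorusLimitPoints r β)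
    (q q' : Fin 4 × Fin 4) (x y : Fin 4 → ℤ) (hq : q.1 < q.2) (hq' : q'.1 < q'.2)
    (hsep : ∃ k : Fin 4, (2 * (R : ℤ) + 4) ≤ |x k - y k|) :
    |stateMomentStr G r μ 2 ![q, q'] ![x, y]| ≤ bnd := by
  obtain ⟨S, hS, hlim⟩ := hμ
  obtain ⟨Cp, hCp⟩ := exists_abs_plane_le (G := G) r
  have hsep2 : ∀ i j : Fin 2, i ≠ j → ∃ m : Fin 4, (2 * (R : ℤ) + 4) ≤ |(![x, y] i) m - (![x, y] j) m| := by
    intro i j hij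
    obtain ⟨k, hk⟩ := hsep
    fin_cases i <;> fin_cases j
    · exact absurd rfl hij
    · exact ⟨k, by simpa using hk⟩
    · exact ⟨k, by simpa [abs_sub_comm] using hk⟩
    · exact absurd rfl hij
  unfold stateMomentStr
  refine abs_integral_centred_prod_le_of_eventually r.ρ r.continuous hlim (fun i => plane G r (![q, q'] i) (![x, y] i))
    (fun i => ⟨_, isCylinder_plane r _ _⟩) (fun i => continuous_plane r _ _)
    (fun i => measurable_plane r _ _) (fun i => ⟨Cp, hCp _ _⟩) ?_
  filter_upwards [eventually_torusSeparated (![x, y]) hsep2 hS, eventually_le_of_strictMono hS (4 * R + 8)]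
    with k hsepk hRk
  have h01 := hsepk 0 1 (by decide)
  simp only [Matrix.cons_val_zero, Matrix.cons_val_one] at h01
  have := h2 (S k) q q' x y hq hq' hRk h01
  simp only [Fin.prod_univ_two, Matrix.cons_val_zero, Matrix.cons_val_one]
  exact this


/-! ## §G Atom geometry: unfolding, sup bound, carrier box, time floor / mirror ceiling -/

/-- Non-vanishing of an atom weight (unfolding lemma). -/
theorem atomWt_ne_zero_iff (b : SchwartzMap (EuclideanSpace ℝ (Fin 4)) ℝ) (Q : Finset (Fin 4 × Fin 4)) (s : ℝ)
    (y : EuclideanSpace ℝ (Fin 4)) (p : (Fin 4 × Fin 4) × (Fin 4 → ℤ)) :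
    atomWt b Q s y p ≠ 0 ↔ (p.1 ∈ Q ∧ p.1.1 < p.1.2) ∧ b (s • (siteToE p.2 + centreOffset p.1) - y) ≠ 0 := by
  unfold atomWt
  by_cases h : p.1 ∈ Q ∧ p.1.1 < p.1.2
  · simp [h]
  · simp [h]

/-- Non-vanishing of a reflected-atom weight (unfolding lemma). -/
theorem atomWr_ne_zero_iff (b : SchwartzMap (EuclideanSpace ℝ (Fin 4)) ℝ) (Q : Finset (Fin 4 × Fin 4)) (s : ℝ)
    (y : EuclideanSpace ℝ (Fin 4)) (p : (Fin 4 × Fin 4) × (Fin 4 → ℤ)) :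
    atomWr b Q s y p ≠ 0 ↔
      (p.1 ∈ Q ∧ p.1.1 < p.1.2) ∧ b (timeReflection 4 (s • (siteToE p.2 + centreOffset p.1)) - y) ≠ 0 := by
  unfold atomWr
  by_cases h : p.1 ∈ Q ∧ p.1.1 < p.1.2
  · simp [h]
  · simp [h]

/-- Sup bound of the atom weights by a sup bound of the profile. -/
theorem abs_atomWt_le {b : SchwartzMap (EuclideanSpace ℝ (Fin 4)) ℝ} {Mb : ℝ} (hMb : ∀ u, |b u| ≤ Mb)
    (Q : Finset (Fin 4 × Fin 4)) (s : ℝ) (y : EuclideanSpace ℝ (Fin 4)) (p : (Fin 4 × Fin 4) × (Fin 4 → ℤ)) :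
    |atomWt b Q s y p| ≤ Mb := by
  have h0 : 0 ≤ Mb := (abs_nonneg _).trans (hMb 0)
  unfold atomWt
  split_ifs
  · exact hMb _
  · simpa using h0

/-- Sup bound of the reflected-atom weights by a sup bound of the profile. -/
theorem abs_atomWr_le {b : SchwartzMap (EuclideanSpace ℝ (Fin 4)) ℝ} {Mb : ℝ} (hMb : ∀ u, |b u| ≤ Mb)
    (Q : Finset (Fin 4 × Fin 4)) (s : ℝ) (y : EuclideanSpace ℝ (Fin 4)) (p : (Fin 4 × Fin 4) × (Fin 4 → ℤ)) :
    |atomWr b Q s y p| ≤ Mb := by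
  have h0 : 0 ≤ Mb := (abs_nonneg _).trans (hMb 0)
  unfold atomWr
  split_ifs
  · exact hMb _
  · simpa using h0

/-- TIME FLOOR of the atom: a plaquette carrying non-zero weight in the `b`-atom of scale `s`, offset `y ∈ [0,s]⁴`,
has base-site time coordinate `≥ δ/s − 1`, where `δ` is a lower bound of the time coordinate on the support of `b`. -/
theorem time_floor_of_wt {b : EuclideanSpace ℝ (Fin 4) → ℝ} {δ : ℝ} (hδ : ∀ u, b u ≠ 0 → δ ≤ u 0)
    {s : ℝ} (hs : 0 < s) {y : EuclideanSpace ℝ (Fin 4)} (hy0 : 0 ≤ y 0) (q : Fin 4 × Fin 4) (x : Fin 4 → ℤ)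
    (h : b (s • (siteToE x + centreOffset q) - y) ≠ 0) : δ / s - 1 ≤ (x 0 : ℝ) := by
  have h1 := hδ _ h
  have h2 : (s • (siteToE x + centreOffset q) - y) 0 = s * ((x 0 : ℝ) + centreOffset q 0) - y 0 := by
    simp [siteToE_apply, smul_eq_mul]; ring
  rw [h2] at h1
  have ho := centreOffset_time q
  have h3 : δ / s ≤ (x 0 : ℝ) + centreOffset q 0 := by
    rw [div_le_iff₀ hs]; nlinarith
  linarith [ho.2]

/-- MIRROR CEILING of the reflected atom: a plaquette carrying non-zero weight in the time-REFLECTED atom has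
base-site time coordinate `≤ −δ/s`. -/
theorem time_ceiling_of_wr {b : EuclideanSpace ℝ (Fin 4) → ℝ} {δ : ℝ} (hδ : ∀ u, b u ≠ 0 → δ ≤ u 0)
    {s : ℝ} (hs : 0 < s) {y : EuclideanSpace ℝ (Fin 4)} (hy0 : 0 ≤ y 0) (q : Fin 4 × Fin 4) (x : Fin 4 → ℤ)
    (h : b (timeReflection 4 (s • (siteToE x + centreOffset q)) - y) ≠ 0) : (x 0 : ℝ) ≤ -(δ / s) := by
  have h1 := hδ _ h
  have h2 : (timeReflection 4 (s • (siteToE x + centreOffset q)) - y) 0 =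
      -(s * ((x 0 : ℝ) + centreOffset q 0)) - y 0 := by
    simp [timeReflection_apply, siteToE_apply, smul_eq_mul]; ring
  rw [h2] at h1
  have ho := centreOffset_time q
  have h3 : (x 0 : ℝ) + centreOffset q 0 ≤ -(δ / s) := by
    rw [show -(δ / s) = (-δ) / s by ring, le_div_iff₀ hs]; nlinarith
  linarith [ho.1]

/-- CARRIER BOX: a plaquette with non-zero weight in the atom or in the reflected atom (scale `s`, offset in
`[0,s]⁴`, profile supported in the ball of radius `t`) has all base-site coordinates of modulus `≤ t/s + 3`. -/
theorem abs_coord_le_of_atom {b : SchwartzMap (EuclideanSpace ℝ (Fin 4)) ℝ} {t : ℝ}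
    (hbt : Function.support b ⊆ Metric.closedBall 0 t) {s : ℝ} (hs : 0 < s) {y : EuclideanSpace ℝ (Fin 4)}
    (hy : ∀ i, 0 ≤ y i ∧ y i ≤ s) {Q : Finset (Fin 4 × Fin 4)} {p : (Fin 4 × Fin 4) × (Fin 4 → ℤ)}
    (h : atomWt b Q s y p ≠ 0 ∨ atomWr b Q s y p ≠ 0) (i : Fin 4) : |(p.2 i : ℝ)| ≤ t / s + 3 := by
  have hy2 : ‖y‖ ≤ 2 * s := norm_le_two_mul_of_box hy
  have key : |(p.2 i : ℝ)| ≤ (t + ‖y‖) / s + 1 := by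
    rcases h with h | h
    · exact abs_coord_le_of_ne_zero hbt hs (norm_centreOffset_le_one p.1) p.2 y _ rfl
        ((atomWt_ne_zero_iff b Q s y p).1 h).2 i
    · exact abs_coord_le_of_ne_zero hbt hs (norm_centreOffset_le_one p.1) p.2 y _
        (LinearIsometryEquiv.norm_map _ _) ((atomWr_ne_zero_iff b Q s y p).1 h).2 i
  have hmono : (t + ‖y‖) / s + 1 ≤ t / s + 3 := by
    rw [add_div]
    have : ‖y‖ / s ≤ 2 := by rw [div_le_iff₀ hs]; linarith
    linarith
  exact key.trans hmono

/-- The carrier finset of the single-orientation atom: orientation `q`, base sites in the box `[-B, B]⁴`. -/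
def carrier (q : Fin 4 × Fin 4) (B : ℕ) : Finset ((Fin 4 × Fin 4) × (Fin 4 → ℤ)) :=
  {q} ×ˢ Fintype.piFinset fun _ : Fin 4 => Finset.Icc (-(B : ℤ)) B

/-- Membership in the carrier box from a coordinate bound. -/
theorem mem_carrier {q : Fin 4 × Fin 4} {B : ℕ} {p : (Fin 4 × Fin 4) × (Fin 4 → ℤ)} (h1 : p.1 = q)
    (h2 : ∀ i, |(p.2 i : ℝ)| ≤ (B : ℝ)) : p ∈ carrier q B := by
  simp only [carrier, Finset.mem_product, Finset.mem_singleton, Fintype.mem_piFinset, Finset.mem_Icc]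
  refine ⟨h1, fun i => ?_⟩
  have : |p.2 i| ≤ (B : ℤ) := by exact_mod_cast h2 i
  exact abs_le.1 this

/-- The carrier box has `(2B+1)⁴` plaquettes. -/
theorem card_carrier (q : Fin 4 × Fin 4) (B : ℕ) : (carrier q B).card = (2 * B + 1) ^ 4 := by
  simp only [carrier, Finset.card_product, Finset.card_singleton, one_mul, Fintype.card_piFinset,
    Finset.prod_const, Finset.card_univ, Fintype.card_fin, Int.card_Icc]
  congr 1
  omega

/-- The atom and the reflected atom of scale `s`, offset `y ∈ [0,s]⁴`, live on `carrier q B` for any natural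
`B ≥ t/s + 3`. -/
theorem atom_subset_carrier {b : SchwartzMap (EuclideanSpace ℝ (Fin 4)) ℝ} {t : ℝ}
    (hbt : Function.support b ⊆ Metric.closedBall 0 t) {s : ℝ} (hs : 0 < s) {y : EuclideanSpace ℝ (Fin 4)}
    (hy : ∀ i, 0 ≤ y i ∧ y i ≤ s) (q : Fin 4 × Fin 4) {B : ℕ} (hB : t / s + 3 ≤ (B : ℝ))
    (p : (Fin 4 × Fin 4) × (Fin 4 → ℤ)) :
    (atomWt b {q} s y p ≠ 0 → p ∈ carrier q B) ∧ (atomWr b {q} s y p ≠ 0 → p ∈ carrier q B) := by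
  refine ⟨fun h => mem_carrier ?_ fun i => (abs_coord_le_of_atom hbt hs hy (Or.inl h) i).trans hB,
    fun h => mem_carrier ?_ fun i => (abs_coord_le_of_atom hbt hs hy (Or.inr h) i).trans hB⟩
  · exact Finset.mem_singleton.1 ((atomWt_ne_zero_iff b {q} s y p).1 h).1.1
  · exact Finset.mem_singleton.1 ((atomWr_ne_zero_iff b {q} s y p).1 h).1.1

end Summit.QuantumFields.YangMills.Cruxes.AtomicCalibrationR.MirrorCalibration

end
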